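import Literature.AnabelianGeometry.SemiGraphs.PSCCoveringBranchData
import Literature.AnabelianGeometry.SemiGraphs.PSCCoveringDatumTransport
import Literature.AnabelianGeometry.SemiGraphs.PSCSturdyCoverProofs
import Literature.AnabelianGeometry.SemiGraphs.ProSigmaCompletionTransport
import HarnessLib

/-!
# "Sturdy" (Def. 1.1 (ii), rank form) for the covering datum `G_V` versus at level `V` ([CombGC] Rmk. 1.1.5)

Mochizuki, *A combinatorial version of the Grothendieck conjecture*, Tohoku Math. J. **59** (2007),
Def. 1.1 (ii) p. 7 ("sturdy": the abelianization of every unramified verticial subgroup of `Π^unr_G`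
is free of rank `> 2` over `Ẑ^Σ`) and Rmk. 1.1.5 p. 8 (sturdy covers) [cite: MochizukiCombGC2007, Rmk 1.1.5 p.8].
The abc-iut [CombGC] Thm 1.6 sub-DAG has TWO renderings of "the covering `G_V` is sturdy": the
level-wise RANK form `G.IsSturdyAt V` of `PSCSturdyCover.lean` (abc-iut-w5-d188; intrinsic to
`V ⊆ Π_G`) and the GENUS form `(G.restrictBD V hV bd).IsSturdy` of the covering datum
(`PSCCoveringDatum.lean` / `PSCCoveringBranchData.lean`, Riemann–Hurwitz genera).  They are linked
only through the origin (Rmk. 1.1.5, first sentence = `SturdyAtTopIffSturdy` applied to the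
Ω-type datum `G_V`).  This PROOF-ONLY file supplies the missing class-(i) bridge
**`isSturdyAt_restrict_top_iff : (G.restrict V hV).IsSturdyAt ⊤ ↔ G.IsSturdyAt V`** (and the same for
`restrictBD V hV bd`, any branch data): Def. 1.1 (ii)'s rank-sturdiness OF THE DATUM `G_V` at its
trivial level is d188's rank-sturdiness of `G` at level `V`.  Ingredients: the edge-like / verticial
subgroups of `Π_{G_V}` are the traces of those of `Π_G` (`PSCCoveringDatumProofs`), hence
`unrKerIn`, `unrVertAt`, `unrVertAbKerAt` of the datum push forward to those of `G` at level `V`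
(`map_subtype_unrKerIn_restrict_top` &c.), and the abelianised unramified verticial subgroups are
isomorphic topological groups along `V ↪ Π_G`, so that "is the pro-`Σ` completion of `ℤ^r`"
transfers (`IsProSigmaCompletion.of_target_mulEquiv`).  So the route «`SturdyCoverHolds Ω` +
`RestrictBDOfPSCTypeHolds Ω` ⇒ genus-sturdy Ω-type coverings» needs no further origin statement.
No definitions; no statement takes a side on [IUTchIII] Cor. 3.12.
-/

namespace Literature.AnabelianGeometry.SemiGraphs

open scoped Pointwise

universe u

namespace PSCDatum

open PSCCovering SemiGraphOfAnabelioids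

variable {P : Type u} [Group P] [TopologicalSpace P] [IsTopologicalGroup P] (G : PSCDatum P)
  (V : Subgroup P) [V.FiniteIndex] (hV : IsOpen (V : Set P))

/-! ### Edge-like / verticial subgroups of `G_V` at its trivial level -/

/-- The edge-like subgroups of `Π_{G_V}` at the trivial level `⊤` are the level-`V` edge-like subgroups
of `G`. [cite: MochizukiCombGC2007, Def 1.1(ii) p.7] -/
theorem isEdgeLikeIn_restrict_top_iff (A : Subgroup V) :
    (G.restrict V hV).IsEdgeLikeIn ⊤ A ↔ G.IsEdgeLikeIn V (A.map V.subtype) := by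
  constructor
  · rintro ⟨B, hB, rfl⟩
    rw [top_inf_eq]
    exact (isEdgeLike_restrict_iff_isEdgeLikeIn hV B).mp hB
  · intro h
    exact ⟨A, (isEdgeLike_restrict_iff_isEdgeLikeIn hV A).mpr h, (top_inf_eq A).symm⟩

/-- The verticial subgroups of `Π_{G_V}` at the trivial level `⊤` are the level-`V` verticial subgroups
of `G`. [cite: MochizukiCombGC2007, Def 1.1(ii) p.6] -/
theorem isVerticialIn_restrict_top_iff (A : Subgroup V) :
    (G.restrict V hV).IsVerticialIn ⊤ A ↔ G.IsVerticialIn V (A.map V.subtype) := by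
  constructor
  · rintro ⟨B, hB, rfl⟩
    rw [top_inf_eq]
    exact (isVerticial_restrict_iff_isVerticialIn hV B).mp hB
  · intro h
    exact ⟨A, (isVerticial_restrict_iff_isVerticialIn hV A).mpr h, (top_inf_eq A).symm⟩

omit [TopologicalSpace P] [IsTopologicalGroup P] [V.FiniteIndex] in
/-- A level-`V` subgroup `A ≤ V` of `Π_G` is the push-forward of its trace on `V`.
[cite: MochizukiCombGC2007, Def 1.1(ii) p.6] -/
theorem map_subtype_subgroupOf_of_le {A : Subgroup P} (hA : A ≤ V) :
    (A.subgroupOf V).map V.subtype = A := by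
  rw [Subgroup.subgroupOf_map_subtype, inf_eq_left.mpr hA]

/-! ### `unrKerIn`, `unrVertAt`, `unrVertAbKerAt` of the datum push forward -/

/-- `Ker(Π_{G_V} ↠ Π^unr_{G_V})` computed in the datum `G_V` (d188's `unrKerIn` at `⊤`) pushes forward to
`G.unrKerIn V`. [cite: MochizukiCombGC2007, Def 1.1(ii) p.7] -/
theorem map_subtype_unrKerIn_restrict_top :
    ((G.restrict V hV).unrKerIn ⊤).map V.subtype = G.unrKerIn V := by
  rw [unrKerIn, unrKerIn, map_subtype_topologicalClosure (Subgroup.isClosed_of_isOpen V hV)]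
  congr 1
  have hsurj : Function.Surjective ((⊤ : Subgroup V).subtype) :=
    fun x => ⟨⟨x, Subgroup.mem_top x⟩, rfl⟩
  rw [Subgroup.map_normalClosure _ _ hsurj]
  have hset : ((⊤ : Subgroup V).subtype '' {x : (⊤ : Subgroup V) | ∃ A : Subgroup V,
      (G.restrict V hV).IsEdgeLikeIn ⊤ A ∧ (x : V) ∈ A}) =
      {y : V | ∃ A : Subgroup P, G.IsEdgeLikeIn V A ∧ (y : P) ∈ A} := by
    ext y
    constructor
    · rintro ⟨x, ⟨A, hA, hx⟩, rfl⟩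
      exact ⟨A.map V.subtype, (G.isEdgeLikeIn_restrict_top_iff V hV A).mp hA, ⟨_, hx, rfl⟩⟩
    · rintro ⟨A, hA, hy⟩
      have hAV : A ≤ V := by obtain ⟨B, -, rfl⟩ := hA; exact inf_le_left
      refine ⟨⟨y, Subgroup.mem_top y⟩, ⟨A.subgroupOf V, ?_, ?_⟩, rfl⟩
      · rw [isEdgeLikeIn_restrict_top_iff, map_subtype_subgroupOf_of_le V hAV]
        exact hA
      · rw [Subgroup.mem_subgroupOf]
        exact hy
  rw [hset]

/-- `unrVertAt` of the datum pushes forward: `(A' · K').map = A · K`.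
[cite: MochizukiCombGC2007, Def 1.1(ii) p.7] -/
theorem map_subtype_unrVertAt_restrict_top (A : Subgroup V) :
    ((G.restrict V hV).unrVertAt ⊤ A).map V.subtype = G.unrVertAt V (A.map V.subtype) := by
  rw [unrVertAt, unrVertAt, Subgroup.map_sup, map_subtype_unrKerIn_restrict_top]

/-- `unrVertAbKerAt` of the datum pushes forward. [cite: MochizukiCombGC2007, Def 1.1(ii) p.7] -/
theorem map_subtype_unrVertAbKerAt_restrict_top (A : Subgroup V) :
    ((G.restrict V hV).unrVertAbKerAt ⊤ A).map V.subtype =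
      G.unrVertAbKerAt V (A.map V.subtype) := by
  rw [unrVertAbKerAt, unrVertAbKerAt, map_subtype_topologicalClosure (Subgroup.isClosed_of_isOpen V hV),
    Subgroup.map_sup, Subgroup.map_commutator, map_subtype_unrVertAt_restrict_top,
    map_subtype_unrKerIn_restrict_top]

/-! ### Transport of quotients of subgroups of `V` along `V ↪ Π_G` -/

section Transport

variable {V}
variable (B C : Subgroup V)

omit [TopologicalSpace P] [IsTopologicalGroup P] [V.FiniteIndex] in
/-- The isomorphism `B ≅ ι(B)` along `V ↪ Π_G` carries the trace of `C` on `B` onto the trace of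
`ι(C)` on `ι(B)`. [cite: MochizukiCombGC2007, Def 1.1(ii) p.7] -/
theorem map_equivMapOfInjective_subgroupOf :
    (C.subgroupOf B).map (B.equivMapOfInjective V.subtype V.subtype_injective :
        B →* (B.map V.subtype)) = (C.map V.subtype).subgroupOf (B.map V.subtype) := by
  set e := B.equivMapOfInjective V.subtype V.subtype_injective
  ext y
  simp only [Subgroup.mem_map, Subgroup.mem_subgroupOf, MonoidHom.coe_coe]
  constructor
  · rintro ⟨x, hx, rfl⟩
    refine ⟨(x : V), hx, ?_⟩
    exact (Subgroup.coe_equivMapOfInjective_apply B V.subtype V.subtype_injective x).symm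
  · rintro ⟨c, hc, hcy⟩
    refine ⟨e.symm y, ?_, e.apply_symm_apply y⟩
    have hval : ((e.symm y : B) : V) = c := by
      apply V.subtype_injective
      have := Subgroup.coe_equivMapOfInjective_apply B V.subtype V.subtype_injective (e.symm y)
      rw [MulEquiv.apply_symm_apply] at this
      rw [← this, hcy]
    rw [hval]; exact hc

omit [IsTopologicalGroup P] [V.FiniteIndex] in
/-- `B ≅ ι(B)` is continuous. [cite: MochizukiCombGC2007, Def 1.1(ii) p.7] -/
theorem continuous_equivMapOfInjective_subtype :
    Continuous (B.equivMapOfInjective V.subtype V.subtype_injective) := by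
  apply continuous_induced_rng.2
  have : (Subtype.val ∘ (B.equivMapOfInjective V.subtype V.subtype_injective) : B → P) =
      fun x : B => ((x : V) : P) := by
    funext x
    exact Subgroup.coe_equivMapOfInjective_apply B V.subtype V.subtype_injective x
  rw [this]
  exact continuous_subtype_val.comp continuous_subtype_val

omit [IsTopologicalGroup P] [V.FiniteIndex] in
/-- `ι(B) ≅ B` is continuous. [cite: MochizukiCombGC2007, Def 1.1(ii) p.7] -/
theorem continuous_equivMapOfInjective_subtype_symm :
    Continuous (B.equivMapOfInjective V.subtype V.subtype_injective).symm := by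
  set e := B.equivMapOfInjective V.subtype V.subtype_injective
  apply continuous_induced_rng.2
  apply continuous_induced_rng.2
  have : (Subtype.val ∘ Subtype.val ∘ e.symm : (B.map V.subtype) → P) =
      fun y : (B.map V.subtype) => (y : P) := by
    funext y
    have := Subgroup.coe_equivMapOfInjective_apply B V.subtype V.subtype_injective (e.symm y)
    rw [MulEquiv.apply_symm_apply] at this
    exact this.symm
  rw [this]
  exact continuous_subtype_val

omit [TopologicalSpace P] [IsTopologicalGroup P] [V.FiniteIndex] in
/-- Normality of the trace transports along `V ↪ Π_G`. [cite: MochizukiCombGC2007, Def 1.1(ii) p.7] -/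
theorem normal_subgroupOf_of_map_eq {B₂ C₂ : Subgroup P} (hB : B.map V.subtype = B₂)
    (hC : C.map V.subtype = C₂) [hn : (C.subgroupOf B).Normal] : (C₂.subgroupOf B₂).Normal := by
  subst hB; subst hC
  rw [← map_equivMapOfInjective_subgroupOf B C]
  exact Subgroup.Normal.map hn _ (B.equivMapOfInjective V.subtype V.subtype_injective).surjective

omit [TopologicalSpace P] [IsTopologicalGroup P] [V.FiniteIndex] in
/-- And conversely. [cite: MochizukiCombGC2007, Def 1.1(ii) p.7] -/
theorem normal_subgroupOf_of_map_eq' {B₂ C₂ : Subgroup P} (hB : B.map V.subtype = B₂)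
    (hC : C.map V.subtype = C₂) [hn' : (C₂.subgroupOf B₂).Normal] : (C.subgroupOf B).Normal := by
  subst hB; subst hC
  set e := B.equivMapOfInjective V.subtype V.subtype_injective
  have h : ((C.map V.subtype).subgroupOf (B.map V.subtype)).comap (e : B →* (B.map V.subtype)) =
      C.subgroupOf B := by
    rw [← map_equivMapOfInjective_subgroupOf B C, Subgroup.comap_map_eq_self_of_injective]
    exact e.injective
  rw [← h]
  infer_instance

omit [V.FiniteIndex] in
/-- **Transport of "is the pro-`Σ` completion of `ℤ^r`" along `V ↪ Π_G`**: `B / (C ∩ B)` (in `V`) and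
`B₂ / (C₂ ∩ B₂)` (their images in `Π_G`) are isomorphic topological groups, so a homomorphism
`Γ → B/(C ∩ B)` exhibiting a pro-`Σ` completion yields one into `B₂/(C₂ ∩ B₂)`.
[cite: MochizukiCombGC2007, Def 1.1(ii) p.7] -/
theorem isProSigmaCompletion_transfer_of_map_eq {B₂ C₂ : Subgroup P} (hB : B.map V.subtype = B₂)
    (hC : C.map V.subtype = C₂) [hn : (C.subgroupOf B).Normal] [hn₂ : (C₂.subgroupOf B₂).Normal]
    {Γ : Type*} [Group Γ] {S : Set ℕ} (ι : Γ →* B ⧸ C.subgroupOf B)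
    (hι : IsProSigmaCompletion S ι) :
    ∃ ι₂ : Γ →* B₂ ⧸ C₂.subgroupOf B₂, IsProSigmaCompletion S ι₂ := by
  subst hB; subst hC
  set e := B.equivMapOfInjective V.subtype V.subtype_injective with he
  let ē := QuotientGroup.congr (C.subgroupOf B) ((C.map V.subtype).subgroupOf (B.map V.subtype))
    e (map_equivMapOfInjective_subgroupOf B C)
  have hē : Continuous ē := by
    refine (QuotientGroup.isOpenQuotientMap_mk.continuous_comp_iff).mp ?_
    have : (ē ∘ QuotientGroup.mk : B → _) = QuotientGroup.mk ∘ e := by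
      funext x; exact QuotientGroup.congr_mk _ _ e (map_equivMapOfInjective_subgroupOf B C) x
    rw [this]
    exact QuotientGroup.continuous_mk.comp (continuous_equivMapOfInjective_subtype B)
  have hē' : Continuous ē.symm := by
    refine (QuotientGroup.isOpenQuotientMap_mk.continuous_comp_iff).mp ?_
    have : (ē.symm ∘ QuotientGroup.mk : (B.map V.subtype) → _) = QuotientGroup.mk ∘ e.symm := by
      funext y
      show ē.symm (QuotientGroup.mk y) = QuotientGroup.mk (e.symm y)
      rw [QuotientGroup.congr_symm]
      exact QuotientGroup.congr_mk _ _ e.symm _ y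
    rw [this]
    exact QuotientGroup.continuous_mk.comp (continuous_equivMapOfInjective_subtype_symm B)
  refine ⟨ē.toMonoidHom.comp ι, hι.of_target_mulEquiv ē.symm hē' ?_ fun x => ?_⟩
  · simpa using hē
  · simp

omit [V.FiniteIndex] in
/-- Converse transport. [cite: MochizukiCombGC2007, Def 1.1(ii) p.7] -/
theorem isProSigmaCompletion_transfer_of_map_eq' {B₂ C₂ : Subgroup P} (hB : B.map V.subtype = B₂)
    (hC : C.map V.subtype = C₂) [hn : (C.subgroupOf B).Normal] [hn₂ : (C₂.subgroupOf B₂).Normal]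
    {Γ : Type*} [Group Γ] {S : Set ℕ} (ι₂ : Γ →* B₂ ⧸ C₂.subgroupOf B₂)
    (hι₂ : IsProSigmaCompletion S ι₂) :
    ∃ ι : Γ →* B ⧸ C.subgroupOf B, IsProSigmaCompletion S ι := by
  subst hB; subst hC
  set e := B.equivMapOfInjective V.subtype V.subtype_injective with he
  let ē := QuotientGroup.congr (C.subgroupOf B) ((C.map V.subtype).subgroupOf (B.map V.subtype))
    e (map_equivMapOfInjective_subgroupOf B C)
  have hē : Continuous ē := by
    refine (QuotientGroup.isOpenQuotientMap_mk.continuous_comp_iff).mp ?_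
    have : (ē ∘ QuotientGroup.mk : B → _) = QuotientGroup.mk ∘ e := by
      funext x; exact QuotientGroup.congr_mk _ _ e (map_equivMapOfInjective_subgroupOf B C) x
    rw [this]
    exact QuotientGroup.continuous_mk.comp (continuous_equivMapOfInjective_subtype B)
  have hē' : Continuous ē.symm := by
    refine (QuotientGroup.isOpenQuotientMap_mk.continuous_comp_iff).mp ?_
    have : (ē.symm ∘ QuotientGroup.mk : (B.map V.subtype) → _) = QuotientGroup.mk ∘ e.symm := by
      funext y
      show ē.symm (QuotientGroup.mk y) = QuotientGroup.mk (e.symm y)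
      rw [QuotientGroup.congr_symm]
      exact QuotientGroup.congr_mk _ _ e.symm _ y
    rw [this]
    exact QuotientGroup.continuous_mk.comp (continuous_equivMapOfInjective_subtype_symm B)
  refine ⟨ē.symm.toMonoidHom.comp ι₂, hι₂.of_target_mulEquiv ē hē hē' fun x => ?_⟩
  simp

end Transport

/-! ### The bridge -/

/-- **Rank-sturdiness of the datum `G_V` at its trivial level is rank-sturdiness of `G` at level `V`**:
`(G.restrict V hV).IsSturdyAt ⊤ ↔ G.IsSturdyAt V` (Def. 1.1 (ii) "sturdy" read in the covering datum
versus d188's level-wise reading; `V` open of finite index). [cite: MochizukiCombGC2007, Rmk 1.1.5 p.8] -/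
theorem isSturdyAt_restrict_top_iff : (G.restrict V hV).IsSturdyAt ⊤ ↔ G.IsSturdyAt V := by
  constructor
  · intro h A hA hn
    have hAV : A ≤ V := by obtain ⟨B, -, rfl⟩ := hA; exact inf_le_left
    have hmapA : (A.subgroupOf V).map V.subtype = A := map_subtype_subgroupOf_of_le V hAV
    have hA'v : (G.restrict V hV).IsVerticialIn ⊤ (A.subgroupOf V) := by
      rw [isVerticialIn_restrict_top_iff, hmapA]; exact hA
    have hB : ((G.restrict V hV).unrVertAt ⊤ (A.subgroupOf V)).map V.subtype = G.unrVertAt V A := by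
      rw [map_subtype_unrVertAt_restrict_top, hmapA]
    have hC : ((G.restrict V hV).unrVertAbKerAt ⊤ (A.subgroupOf V)).map V.subtype =
        G.unrVertAbKerAt V A := by
      rw [map_subtype_unrVertAbKerAt_restrict_top, hmapA]
    haveI := normal_subgroupOf_of_map_eq' _ _ hB hC
    obtain ⟨r, hr, ι, hι⟩ := h (A.subgroupOf V) hA'v
    exact ⟨r, hr, isProSigmaCompletion_transfer_of_map_eq _ _ hB hC ι hι⟩
  · intro h A' hA' hn'
    have hAv : G.IsVerticialIn V (A'.map V.subtype) := (G.isVerticialIn_restrict_top_iff V hV A').mp hA'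
    have hB : ((G.restrict V hV).unrVertAt ⊤ A').map V.subtype = G.unrVertAt V (A'.map V.subtype) :=
      map_subtype_unrVertAt_restrict_top G V hV A'
    have hC : ((G.restrict V hV).unrVertAbKerAt ⊤ A').map V.subtype =
        G.unrVertAbKerAt V (A'.map V.subtype) :=
      map_subtype_unrVertAbKerAt_restrict_top G V hV A'
    haveI := normal_subgroupOf_of_map_eq _ _ hB hC
    obtain ⟨r, hr, ι, hι⟩ := h (A'.map V.subtype) hAv
    exact ⟨r, hr, isProSigmaCompletion_transfer_of_map_eq' _ _ hB hC ι hι⟩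

/-- The same for the loop-faithful datum with any branch data (class (i): `IsSturdyAt` does not read the
node attachments). [cite: MochizukiCombGC2007, Rmk 1.1.5 p.8] -/
theorem isSturdyAt_restrictBD_top_iff (bd : G.BranchData) :
    (G.restrictBD V hV bd).IsSturdyAt ⊤ ↔ G.IsSturdyAt V :=
  G.isSturdyAt_restrict_top_iff V hV

end PSCDatum

end Literature.AnabelianGeometry.SemiGraphs
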